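import Mathlib.Analysis.InnerProductSpace.l2Space
import Mathlib.Analysis.InnerProductSpace.Adjoint
import HarnessLib

/-!
# Rayleigh upper bound from an eigenbasis (stub `stub_inner_le_of_eigen_le` of line `twisted_trace_transfer`,
crux `QuarksAsStableAction.StableActionBridge`, stmt-QuantumFields-9737; Layer A of step E3)

For a self-adjoint bounded operator `A` on a complex Hilbert space with a Hilbert basis of eigenvectors
`A bᵢ = λᵢ bᵢ` (`λᵢ ∈ ℝ`) and `λᵢ ≤ Λ` for all `i`, `Re ⟪v, A v⟫ ≤ Λ ‖v‖²` for every `v`.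
Proof: Parseval (`HilbertBasis.hasSum_inner_mul_inner`) gives `⟪v, A v⟫ = Σᵢ ⟪v, bᵢ⟫ ⟪bᵢ, A v⟫ = Σᵢ λᵢ |⟪bᵢ, v⟫|²`
(self-adjointness moves `A` onto `bᵢ`) and `‖v‖² = Σᵢ |⟪bᵢ, v⟫|²`; compare termwise (`hasSum_le`).  In E3 this is the
inequality `sup (Rayleigh quotient) ≤ λ_max` identifying the tree's top min–max level `qcdTransferLevel … 0` with the top
eigenvalue of Lüscher's transfer operator. Mathlib only. [folklore]
-/

noncomputable section

open scoped InnerProductSpace ComplexConjugate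

namespace Summit.QuantumFields.QCD.Cruxes.StableActionBridge.TwistedTraceTransfer

/-- **Rayleigh upper bound from an eigenbasis** (sub-goal A3 of E3): for a self-adjoint bounded operator `A` on a complex
Hilbert space with a Hilbert basis of eigenvectors `A bᵢ = λᵢ bᵢ` and `λᵢ ≤ Λ` for all `i`, `Re ⟪v, A v⟫ ≤ Λ ‖v‖²`. [folklore] -/
theorem stub_inner_le_of_eigen_le : ∀ (E : Type) [NormedAddCommGroup E] [InnerProductSpace ℂ E] [CompleteSpace E]
    (A : E →L[ℂ] E), IsSelfAdjoint A → ∀ (ι : Type) (b : HilbertBasis ι ℂ E) (lam : ι → ℝ),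
    (∀ i, A (b i) = (lam i : ℂ) • b i) → ∀ Λ : ℝ, (∀ i, lam i ≤ Λ) →
    ∀ v : E, (⟪v, A v⟫_ℂ).re ≤ Λ * ‖v‖ ^ 2 := by
  intro E _ _ _ A hA ι b lam hb Λ hΛ v
  have h1 : HasSum (fun i => ⟪v, b i⟫_ℂ * ⟪b i, A v⟫_ℂ) ⟪v, A v⟫_ℂ := b.hasSum_inner_mul_inner v (A v)
  have h2 : HasSum (fun i => ⟪v, b i⟫_ℂ * ⟪b i, v⟫_ℂ) ⟪v, v⟫_ℂ := b.hasSum_inner_mul_inner v v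
  have hbA : ∀ i, ⟪b i, A v⟫_ℂ = (lam i : ℂ) * ⟪b i, v⟫_ℂ := by
    intro i
    rw [← hA.adjoint_eq, ContinuousLinearMap.adjoint_inner_right, hb i, inner_smul_left,
      Complex.conj_ofReal]
  have hsq : ∀ i, ⟪v, b i⟫_ℂ * ⟪b i, v⟫_ℂ = ((‖⟪b i, v⟫_ℂ‖ ^ 2 : ℝ) : ℂ) := by
    intro i
    rw [← inner_conj_symm v (b i), Complex.conj_mul', Complex.ofReal_pow]
  have key1 : ∀ i, (⟪v, b i⟫_ℂ * ⟪b i, A v⟫_ℂ).re = lam i * ‖⟪b i, v⟫_ℂ‖ ^ 2 := by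
    intro i
    rw [hbA i, mul_left_comm, hsq i, ← Complex.ofReal_mul, Complex.ofReal_re]
  have key2 : ∀ i, (⟪v, b i⟫_ℂ * ⟪b i, v⟫_ℂ).re = ‖⟪b i, v⟫_ℂ‖ ^ 2 := by
    intro i
    rw [hsq i, Complex.ofReal_re]
  have h1re : HasSum (fun i => lam i * ‖⟪b i, v⟫_ℂ‖ ^ 2) (⟪v, A v⟫_ℂ).re := by
    have h := Complex.reCLM.hasSum h1
    simp only [Complex.reCLM_apply] at h
    simpa only [key1] using h
  have h2re : HasSum (fun i => Λ * ‖⟪b i, v⟫_ℂ‖ ^ 2) (Λ * ‖v‖ ^ 2) := by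
    have h := Complex.reCLM.hasSum h2
    simp only [Complex.reCLM_apply, key2] at h
    have hn : (⟪v, v⟫_ℂ).re = ‖v‖ ^ 2 := by
      rw [inner_self_eq_norm_sq_to_K]; norm_cast
    rw [hn] at h
    exact h.mul_left Λ
  exact hasSum_le (fun i => mul_le_mul_of_nonneg_right (hΛ i) (sq_nonneg _)) h1re h2re

end Summit.QuantumFields.QCD.Cruxes.StableActionBridge.TwistedTraceTransfer

end
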